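import Literature.MathematicalPhysics.QuantumFieldTheory.BalabanImbrieJaffe1984to88.BIJ88GaussIntegration309Product
import Literature.MathematicalPhysics.QuantumFieldTheory.BalabanImbrieJaffe1984to88.BIJ88RestrictionsVanish308
import Mathlib.Analysis.Calculus.ParametricIntegral

/-!
# `BalabanImbrieJaffe1984to88.BIJ88InterpolatedRestrictions308` — T. Bałaban, J. Imbrie, A. Jaffe, *Effective action and cluster
properties of the abelian Higgs model*, Commun. Math. Phys. **114** (1988) 257–315 [BalabanImbrieJaffe1988]: Sect. 5.14, p. 308 [PDF 52],
*"Define z_t(Λ₁₂^{(k)}) for t ∈ [0,1] by … replacing χ(cp(e_k), (I−Q^{s*}Q)A^{(k)}) with χ(cp(te_k), (I−Q^{s*}Q)A^{(k)}), and similarly for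
χ(cp(e_k), φ^{(k)}). Thus the restrictions and the interactions disappear at t = 0, at which point we have a purely Gaussian expectation
… 𝒫_{k+1} = Σ_{α=1}^{n̄} −(1/α!)(dᵅ/dtᵅ) log z_t|_{t=0} … We express each d/dt as a sum …"* — the t-DERIVATIVES OF THE EXPECTATION of the
interpolated restrictions `z(t) = ∫ χ′_{Λ,t} dμ`, `χ′_{Λ,t} = Π_{b∈B} χ(c_b·p(te_k), Φ_b)`.

statement-level skeleton of published theorems with citation tags; proofs where landed; nothing here is a claim about the Yang–Mills mass gap

ERRATUM (v1.1, docstring only; referee ref-1 gen 27/28, render `lit-balaban-r16/renders/cmp114/original-p052-x2.png`): print's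
(5.14.1) carries a leading MINUS — 𝒫_{k+1}(Λ₁₂^{(k)}) = Σ_{α=1}^{n̄} −(1/α!)(dᵅ/dtᵅ) log z_t(Λ₁₂^{(k)})|_{t=0} — and so does the
remainder (5.14.2), ℛ_k(Λ₁₂^{(k)}) = ∫₀¹ dt −((1−t)^{n̄}/(n̄+1)!)⟨d/dt; …; d/dt⟩_t; the v1 quotation dropped the sign.  Declarations are
unchanged (the minus lives inside `BIJ88Perturbative341.pertPart`).

WHAT THIS FILE ADDS to this seat's p. 308/309 chain (`BIJ88RestrictionsVanish308`: one factor → 1 pointwise as t → 0⁺;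
`BIJ88GaussIntegration309Product`: pointwise bounds for (d/dt)ⁿχ′ and their integrals).  The displays (5.14.1)–(5.14.3) differentiate
EXPECTATIONS in `t`; here the exchange of `d/dt` and `∫` is PROVED:

* **§1 the integrand** — `ω ↦ χ′_{Λ,t}(Φ(ω))` is measurable and bounded by `1` (`measurable_prod_cutoff_t`, `abs_prod_cutoff_t_le_one`), and
  `s ↦ χ′_{Λ,s}(A)` is differentiable on the open branch `0 < s`, `se_k < 1` with an explicit Leibniz derivative (`hasDerivAt_prod_cutoff_t`,
  from gen 4's chain rule `BIJ88ChiTDeriv309.hasDerivAt_cutoff_t`), measurable in the fields (`measurable_derivProd`).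
* **§2 differentiation under the integral sign** — for ANY finite measure μ and measurable fields, on the branch `0 < t₀`, `t₀e_k < e^{−1}`:
  `z(t) = ∫ χ′_{Λ,t} dμ` has derivative `z′(t₀) = ∫ (d/dt)χ′_{Λ,t}|_{t₀} dμ` (`hasDerivAt_integral_prod_cutoff_t`; dominated by the uniform bound
  `NĈ·(t₀/2)^{−1}` of `…309Product` on a neighbourhood), the derivative integrand is integrable, and
  `|z′(t₀)| ≤ NĈ·t₀^{−1}·Σ_b μ{(9/10)|c_b|p(t₀e_k) ≤ |Φ_b|}` (`abs_deriv_integral_prod_cutoff_t_le`).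
* **§3 "the restrictions disappear at t = 0", integrated** — `z(t) → μ(Ω)` as `t → 0⁺` (`tendsto_integral_prod_cutoff_t_zero`, dominated
  convergence with the pointwise limit of `BIJ88RestrictionsVanish308.tendsto_cutoff_t_one`); for a probability measure `z(t) → 1 = z(0)`.

PDF held: `paper:balaban1988-cmp114-bij-abelian-higgs-effective-action` (journal page = PDF page + 256); p. 308 [PDF 52].

CITATION HEADER (lean-in-tree rule).  Part of the lit-balaban TYPED SKELETON (HOME `run/shared/lean/pub/lit-balaban/`), Phase 2,
seat p36 (gen 7, unit `lit-balaban-p36`); rows **C2.Eq5.14.1-5.14.2** / **C2.Eq5.14.3-5.14.4** of `HOME/lit-balaban-r16/ROWS-C2-part2.md`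
(owner r16; typed leaves untouched).  Theorems only; no definitions, no `Prop` facts; axioms standard.
-/

namespace Literature.MathematicalPhysics.QuantumFieldTheory.BalabanImbrieJaffe1984to88.BIJ88InterpolatedRestrictions308

open MeasureTheory Filter Set
open BIJ88Sect2Statements (pLog eK)
open BIJ88Sect5Statements (CutoffProfile cutoff)
open scoped Topology

/-! ## §1 The integrand `χ′_{Λ,t}(Φ(ω)) = Π_b χ(c_b·p(te_k), Φ_b(ω))`: measurability, bound, t-derivative -/

section Integrand

variable (χ : CutoffProfile) {ι Ω : Type*} [MeasurableSpace Ω]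

/-- `|χ′_{Λ,t}| ≤ 1` ((5.2.3) at order 0, factor by factor). [cite: BalabanImbrieJaffe1988, (5.14.2) p.308] -/
theorem abs_prod_cutoff_t_le_one (p : ℝ) (B : Finset ι) (A c : ι → ℝ) (ek t : ℝ) :
    |∏ b ∈ B, cutoff χ (c b * pLog p (t * ek)) (A b)| ≤ 1 := by
  rw [Finset.abs_prod]
  exact Finset.prod_le_one (fun b _ => abs_nonneg _) fun b _ => BIJ88GaussIntegration309Product.abs_cutoff_le_one χ _ _

/-- `ω ↦ χ′_{Λ,t}(Φ(ω))` is measurable for measurable fields. [cite: BalabanImbrieJaffe1988, (5.14.2) p.308] -/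
theorem measurable_prod_cutoff_t (p : ℝ) (B : Finset ι) {Φ : ι → Ω → ℝ} (hΦ : ∀ b ∈ B, Measurable (Φ b)) (c : ι → ℝ) (ek t : ℝ) :
    Measurable fun ω => ∏ b ∈ B, cutoff χ (c b * pLog p (t * ek)) (Φ b ω) := by
  refine Finset.measurable_fun_prod B fun b hb => ?_
  exact χ.smooth.continuous.measurable.comp ((hΦ b hb).div_const _)

/-- **The t-derivative of χ′_{Λ,t} (Leibniz)** on the open branch `0 < t`, `te_k < 1`, with gen 4's chain rule for each factor:
`(d/dt) Π_b χ_b = Σ_b (Π_{b'≠b} χ_{b'}) · χ′(1, A_b/(c_b p))·(−A_b/(c_b p²))·(d/dt)p(te_k)`. [cite: BalabanImbrieJaffe1988, (5.14.3) p.309] -/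
theorem hasDerivAt_prod_cutoff_t [DecidableEq ι] (p : ℝ) (B : Finset ι) (A c : ι → ℝ) {ek t : ℝ} (hc : ∀ b ∈ B, c b ≠ 0) (hek : 0 < ek)
    (ht : 0 < t) (h1 : t * ek < 1) :
    HasDerivAt (fun s => ∏ b ∈ B, cutoff χ (c b * pLog p (s * ek)) (A b))
      (∑ b ∈ B, (∏ b' ∈ B.erase b, cutoff χ (c b' * pLog p (t * ek)) (A b')) •
        (deriv χ.χ₁ (A b / (c b * pLog p (t * ek))) *
          (-(A b / (c b * pLog p (t * ek) ^ 2)) * (-(p * (-Real.log (t * ek)) ^ (p - 1)) / t)))) t :=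
  HasDerivAt.fun_finsetProd fun b hb => BIJ88ChiTDeriv309.hasDerivAt_cutoff_t χ p ht hek h1 (hc b hb) (A b)

/-- The Leibniz derivative of `χ′_{Λ,t}` is measurable in the fields (a finite sum of products of continuous functions of the `Φ_b`).
[cite: BalabanImbrieJaffe1988, (5.14.3) p.309] -/
theorem measurable_derivProd [DecidableEq ι] (p : ℝ) (B : Finset ι) {Φ : ι → Ω → ℝ} (hΦ : ∀ b ∈ B, Measurable (Φ b)) (c : ι → ℝ)
    (ek t : ℝ) :
    Measurable fun ω => ∑ b ∈ B, (∏ b' ∈ B.erase b, cutoff χ (c b' * pLog p (t * ek)) (Φ b' ω)) •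
        (deriv χ.χ₁ (Φ b ω / (c b * pLog p (t * ek))) *
          (-(Φ b ω / (c b * pLog p (t * ek) ^ 2)) * (-(p * (-Real.log (t * ek)) ^ (p - 1)) / t))) := by
  have hχ' : Continuous (deriv χ.χ₁) := χ.smooth.continuous_deriv (by exact_mod_cast le_top)
  refine Finset.measurable_sum B fun b hb => ?_
  have hA : Measurable fun ω => ∏ b' ∈ B.erase b, cutoff χ (c b' * pLog p (t * ek)) (Φ b' ω) :=
    Finset.measurable_fun_prod _ fun b' hb' =>
      χ.smooth.continuous.measurable.comp ((hΦ b' (Finset.mem_of_mem_erase hb')).div_const _)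
  have hB : Measurable fun ω => deriv χ.χ₁ (Φ b ω / (c b * pLog p (t * ek))) *
      (-(Φ b ω / (c b * pLog p (t * ek) ^ 2)) * (-(p * (-Real.log (t * ek)) ^ (p - 1)) / t)) :=
    (hχ'.measurable.comp ((hΦ b hb).div_const _)).mul (((hΦ b hb).div_const _).neg.mul_const _)
  exact hA.smul hB

end Integrand

/-! ## §2 Differentiation under the integral sign: `z′(t₀) = ∫ (d/dt)χ′_{Λ,t}|_{t₀} dμ` -/

section UnderIntegral

variable (χ : CutoffProfile) {ι Ω : Type*} [MeasurableSpace Ω]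

/-- **p. 308/(5.14.3): the t-derivative passes under the expectation.**  For ANY finite measure μ, measurable fields `Φ_b`, thresholds
`c_b ≠ 0`, `0 < e_k`, and `t₀` on the branch `0 < t₀`, `t₀e_k < e^{−1}`: the function `z(t) = ∫ Π_b χ(c_b·p(te_k), Φ_b) dμ` is
differentiable at `t₀` with `z′(t₀) = ∫ (d/dt)|_{t₀} Π_b χ(c_b·p(te_k), Φ_b) dμ`, and the derivative integrand is integrable (dominated on
`(t₀/2, e^{−1}/e_k)` by the constant `NĈ·(t₀/2)^{−1}` of `BIJ88GaussIntegration309Product`). [cite: BalabanImbrieJaffe1988, (5.14.3) p.309] -/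
theorem hasDerivAt_integral_prod_cutoff_t (p : ℝ) (μ : Measure Ω) [IsFiniteMeasure μ] (B : Finset ι) {Φ : ι → Ω → ℝ}
    (hΦ : ∀ b ∈ B, Measurable (Φ b)) {c : ι → ℝ} (hc : ∀ b ∈ B, c b ≠ 0) {ek t₀ : ℝ} (hek : 0 < ek) (ht₀ : 0 < t₀)
    (h1 : t₀ * ek < Real.exp (-1)) :
    Integrable (fun ω => deriv (fun s => ∏ b ∈ B, cutoff χ (c b * pLog p (s * ek)) (Φ b ω)) t₀) μ ∧
      HasDerivAt (fun t => ∫ ω, ∏ b ∈ B, cutoff χ (c b * pLog p (t * ek)) (Φ b ω) ∂μ)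
        (∫ ω, deriv (fun s => ∏ b ∈ B, cutoff χ (c b * pLog p (s * ek)) (Φ b ω)) t₀ ∂μ) t₀ := by
  classical
  -- the neighbourhood of t₀ inside the branch
  set s : Set ℝ := Set.Ioo (t₀ / 2) (Real.exp (-1) / ek) with hs
  have ht₀s : t₀ ∈ s := ⟨by linarith, by rwa [lt_div_iff₀ hek]⟩
  have hsn : s ∈ 𝓝 t₀ := isOpen_Ioo.mem_nhds ht₀s
  have hs_pos : ∀ x ∈ s, 0 < x := fun x hx => by linarith [hx.1]
  have hs_le : ∀ x ∈ s, x * ek ≤ Real.exp (-1) := fun x hx => by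
    have := hx.2; rw [lt_div_iff₀ hek] at this; exact this.le
  have hs_lt : ∀ x ∈ s, x * ek < 1 := fun x hx =>
    (hs_le x hx).trans_lt (by rw [← Real.exp_zero]; exact Real.exp_lt_exp.mpr (by norm_num))
  -- the uniform constant for the first derivative
  obtain ⟨C, hC1, hC⟩ := BIJ88GaussIntegration309Product.abs_iteratedDeriv_prod_cutoff_t_le (ι := ι) χ p 1
  set K : ℝ := (B.card : ℝ) * C * (t₀ / 2)⁻¹ with hK
  -- the derivative field F'
  set F' : ℝ → Ω → ℝ := fun x ω => deriv (fun s => ∏ b ∈ B, cutoff χ (c b * pLog p (s * ek)) (Φ b ω)) x with hF'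
  have hderiv : ∀ ω, ∀ x ∈ s, HasDerivAt (fun s => ∏ b ∈ B, cutoff χ (c b * pLog p (s * ek)) (Φ b ω)) (F' x ω) x := by
    intro ω x hx
    have h := hasDerivAt_prod_cutoff_t χ p B (fun b => Φ b ω) c hc hek (hs_pos x hx) (hs_lt x hx)
    rw [hF']
    beta_reduce
    rw [h.deriv]
    exact h
  have hF'meas : ∀ x ∈ s, Measurable (F' x) := by
    intro x hx
    have heq : F' x = fun ω => ∑ b ∈ B, (∏ b' ∈ B.erase b, cutoff χ (c b' * pLog p (x * ek)) (Φ b' ω)) •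
        (deriv χ.χ₁ (Φ b ω / (c b * pLog p (x * ek))) *
          (-(Φ b ω / (c b * pLog p (x * ek) ^ 2)) * (-(p * (-Real.log (x * ek)) ^ (p - 1)) / x))) := by
      funext ω
      exact (hasDerivAt_prod_cutoff_t χ p B (fun b => Φ b ω) c hc hek (hs_pos x hx) (hs_lt x hx)).deriv
    rw [heq]
    exact measurable_derivProd χ p B hΦ c ek x
  have hbound : ∀ ω, ∀ x ∈ s, ‖F' x ω‖ ≤ K := by
    intro ω x hx
    have h := hC B (fun b => Φ b ω) c hc hek (hs_pos x hx) (hs_le x hx) 1 le_rfl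
    rw [iteratedDeriv_one, pow_one, show (-((1 : ℕ) : ℤ)) = -1 from rfl, zpow_neg_one] at h
    rw [Real.norm_eq_abs, hF']
    refine h.trans ?_
    rw [hK]
    have hx0 : 0 < x := hs_pos x hx
    have hxinv : x⁻¹ ≤ (t₀ / 2)⁻¹ := by
      rw [inv_le_inv₀ hx0 (by linarith)]; exact hx.1.le
    exact mul_le_mul_of_nonneg_left hxinv (mul_nonneg (Nat.cast_nonneg _) (by linarith))
  refine hasDerivAt_integral_of_dominated_loc_of_deriv_le (F' := F') (bound := fun _ => K) hsn ?_ ?_ ?_ ?_ ?_ ?_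
  · exact Filter.Eventually.of_forall fun x => (measurable_prod_cutoff_t χ p B hΦ c ek x).aestronglyMeasurable
  · refine (integrable_const (1 : ℝ)).mono' (measurable_prod_cutoff_t χ p B hΦ c ek t₀).aestronglyMeasurable ?_
    exact Filter.Eventually.of_forall fun ω => by
      rw [Real.norm_eq_abs]; exact abs_prod_cutoff_t_le_one χ p B (fun b => Φ b ω) c ek t₀
  · exact (hF'meas t₀ ht₀s).aestronglyMeasurable
  · exact Filter.Eventually.of_forall fun ω x hx => hbound ω x hx
  · exact integrable_const K
  · exact Filter.Eventually.of_forall fun ω x hx => hderiv ω x hx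

/-- `z(t)` is differentiable on the branch `(0, e^{−1}/e_k)`. [cite: BalabanImbrieJaffe1988, (5.14.3) p.309] -/
theorem differentiableOn_integral_prod_cutoff_t (p : ℝ) (μ : Measure Ω) [IsFiniteMeasure μ] (B : Finset ι) {Φ : ι → Ω → ℝ}
    (hΦ : ∀ b ∈ B, Measurable (Φ b)) {c : ι → ℝ} (hc : ∀ b ∈ B, c b ≠ 0) {ek : ℝ} (hek : 0 < ek) :
    DifferentiableOn ℝ (fun t => ∫ ω, ∏ b ∈ B, cutoff χ (c b * pLog p (t * ek)) (Φ b ω) ∂μ)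
      (Set.Ioo 0 (Real.exp (-1) / ek)) := by
  intro t ht
  have h1 : t * ek < Real.exp (-1) := by rw [← lt_div_iff₀ hek]; exact ht.2
  exact (hasDerivAt_integral_prod_cutoff_t χ p μ B hΦ hc hek ht.1 h1).2.differentiableAt.differentiableWithinAt

/-- **The derivative of the expectation is controlled by the tails**: on the branch,
`|z′(t₀)| ≤ N·Ĉ·t₀^{−1}·Σ_{b∈B} μ{(9/10)|c_b|p(t₀e_k) ≤ |Φ_b|}` with the constant `Ĉ = Ĉ(χ,p,1)` of
`BIJ88GaussIntegration309Product.integral_abs_iteratedDeriv_prod_cutoff_t_le_measureReal`. [cite: BalabanImbrieJaffe1988, (5.14.4) p.309] -/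
theorem abs_deriv_integral_prod_cutoff_t_le (p : ℝ) :
    ∃ C : ℝ, 1 ≤ C ∧ ∀ (μ : Measure Ω) [IsFiniteMeasure μ] (B : Finset ι) (Φ : ι → Ω → ℝ) (c : ι → ℝ),
      (∀ b ∈ B, Measurable (Φ b)) → (∀ b ∈ B, c b ≠ 0) → ∀ ⦃ek t₀ : ℝ⦄, 0 < ek → 0 < t₀ → t₀ * ek < Real.exp (-1) →
        |deriv (fun t => ∫ ω, ∏ b ∈ B, cutoff χ (c b * pLog p (t * ek)) (Φ b ω) ∂μ) t₀| ≤
          (B.card : ℝ) * C * t₀⁻¹ * ∑ b ∈ B, μ.real {ω | 9 / 10 * (|c b| * pLog p (t₀ * ek)) ≤ |Φ b ω|} := by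
  obtain ⟨C, hC1, hC⟩ := BIJ88GaussIntegration309Product.integral_abs_iteratedDeriv_prod_cutoff_t_le_measureReal (ι := ι) (Ω := Ω) χ p 1
  refine ⟨C, hC1, ?_⟩
  intro μ _ B Φ c hΦ hc ek t₀ hek ht₀ h1
  have hmain := hasDerivAt_integral_prod_cutoff_t χ p μ B hΦ hc hek ht₀ h1
  rw [hmain.2.deriv]
  refine (abs_integral_le_integral_abs).trans ?_
  have h := hC μ B Φ c hΦ hc hek ht₀ h1.le 1 le_rfl le_rfl
  simp only [iteratedDeriv_one, pow_one] at h
  rw [show (-((1 : ℕ) : ℤ)) = -1 from rfl, zpow_neg_one] at h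
  exact h

end UnderIntegral

/-! ## §3 *"the restrictions … disappear at t = 0"*, integrated: `z(t) → μ(Ω)` as `t → 0⁺` -/

section Limit

variable (χ : CutoffProfile) {ι Ω : Type*} [MeasurableSpace Ω]

/-- **p. 308, integrated**: for positive thresholds `c_b > 0`, `p > 0`, `e_k > 0`, ANY finite measure and measurable fields,
`∫ Π_b χ(c_b·p(te_k), Φ_b) dμ → μ(Ω)` as `t → 0⁺` (dominated convergence, each factor → 1 pointwise by
`BIJ88RestrictionsVanish308.tendsto_cutoff_t_one`). [cite: BalabanImbrieJaffe1988, (5.14.2) p.308] -/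
theorem tendsto_integral_prod_cutoff_t_zero {p : ℝ} (hp : 0 < p) (μ : Measure Ω) [IsFiniteMeasure μ] (B : Finset ι)
    {Φ : ι → Ω → ℝ} (hΦ : ∀ b ∈ B, Measurable (Φ b)) {c : ι → ℝ} (hc : ∀ b ∈ B, 0 < c b) {ek : ℝ} (hek : 0 < ek) :
    Tendsto (fun t => ∫ ω, ∏ b ∈ B, cutoff χ (c b * pLog p (t * ek)) (Φ b ω) ∂μ) (𝓝[>] (0 : ℝ)) (𝓝 (μ.real Set.univ)) := by
  have hlim : Tendsto (fun t => ∫ ω, ∏ b ∈ B, cutoff χ (c b * pLog p (t * ek)) (Φ b ω) ∂μ) (𝓝[>] (0 : ℝ))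
      (𝓝 (∫ _ : Ω, (1 : ℝ) ∂μ)) := by
    refine tendsto_integral_filter_of_dominated_convergence (fun _ => (1 : ℝ)) ?_ ?_ (integrable_const 1) ?_
    · exact Filter.Eventually.of_forall fun t => (measurable_prod_cutoff_t χ p B hΦ c ek t).aestronglyMeasurable
    · exact Filter.Eventually.of_forall fun t => Filter.Eventually.of_forall fun ω => by
        rw [Real.norm_eq_abs]; exact abs_prod_cutoff_t_le_one χ p B (fun b => Φ b ω) c ek t
    · refine Filter.Eventually.of_forall fun ω => ?_
      have h := tendsto_finsetProd B (f := fun b t => cutoff χ (c b * pLog p (t * ek)) (Φ b ω)) (a := fun _ => (1 : ℝ))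
        (x := 𝓝[>] (0 : ℝ)) fun b hb => BIJ88RestrictionsVanish308.tendsto_cutoff_t_one χ (hc b hb) hp hek (Φ b ω)
      simpa using h
  rwa [integral_const, smul_eq_mul, mul_one] at hlim

/-- For a probability measure: `z(t) = ∫ χ′_{Λ,t} dP → 1 = z(0)` as `t → 0⁺` (*"at which point we have a purely Gaussian expectation"*).
[cite: BalabanImbrieJaffe1988, (5.14.2) p.308] -/
theorem tendsto_integral_prod_cutoff_t_one {p : ℝ} (hp : 0 < p) (P : Measure Ω) [IsProbabilityMeasure P] (B : Finset ι)
    {Φ : ι → Ω → ℝ} (hΦ : ∀ b ∈ B, Measurable (Φ b)) {c : ι → ℝ} (hc : ∀ b ∈ B, 0 < c b) {ek : ℝ} (hek : 0 < ek) :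
    Tendsto (fun t => ∫ ω, ∏ b ∈ B, cutoff χ (c b * pLog p (t * ek)) (Φ b ω) ∂P) (𝓝[>] (0 : ℝ)) (𝓝 1) := by
  have h := tendsto_integral_prod_cutoff_t_zero χ hp P B hΦ hc hek
  rwa [probReal_univ] at h

end Limit

end Literature.MathematicalPhysics.QuantumFieldTheory.BalabanImbrieJaffe1984to88.BIJ88InterpolatedRestrictions308
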